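import Summits.Schanuel.Schanuel.Theorems.ZilberEacResonantGraphSurface
import Mathlib.Data.Fintype.Pigeonhole
import HarnessLib

/-!
# The equimodular class, VII: RATIONAL resonance — `c ∈ -(i/2π)ℚ^×`, fibre limit `e^{τ + iπr}`,
# `r ∈ ℚ`

HONEST FRAMING.  Cell `pub-schanuel` (Zilber's Exponential-Algebraic Closedness, case ladder;
host summit Schanuel), seat 2, gen 22.  File VI decided the resonant degenerate graph surfaces with
INTEGER resonance (`c = -im/(2π)`, fibre limit `e^τ`).  Over a base `x₁ = c(x₀ - τ)² + κ` with
`c = -ix/(2π)` (every parabola of the equimodular class has `c ∈ iℝ`) and a rational fibre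
`A(x₀)y₀ + B(x₀) = 0` whose limit root is `e^{τ + iπr}` (the equimodular circle is `|θ| = |e^τ|`), the
exact identity of file V reads `e^{x₁} = exp(c(iπr + 2πik)²)·w(1/x₀)`; when `x, r ∈ ℚ` the phase factor
takes FINITELY many values (period `den x · den r` in `k`), so on an infinite subsequence of the
exponential points `y₁ = ζ·w(1/x₀)` with a constant `ζ ≠ 0`, and THEOREM T applies:
**`unprojectedDense_ratResonantGraphSurface`**, with the case certificate, and the member
**`{x₁ = -i x₀²/(4π), x₀ y₀ + x₀ + 1 = 0}`** (`x = 1/2`, fibre limit `-1 = e^{iπ}`).  NOT decided here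
(precisely): `x ∉ ℚ` or `arg θ - Im τ ∉ πℚ` (equidistributed phases: a Diophantine question on
`k ↦ x(φ + 2πk)²`), fibre curves of `y₀`-degree `≥ 2`, and the non-degenerate equimodular members.
Complete classes of instances of an OPEN question (PLMS 2024 §1 p. 5); EC(3,2) OPEN; NOT Schanuel's
conjecture (neither used nor implied; EAC ⇏ SC).
-/

noncomputable section

open Filter Topology Set Complex MvPolynomial
open Literature.NumberTheory.Transcendental Literature.ModelTheory.Zilber
open Literature.ModelTheory.ExponentialFields

set_option linter.dupNamespace false

namespace Summit.Schanuel.Schanuel.Theorems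

/-! ## Part A. Scaling the witness; periodicity of the resonant phase -/

/-- Transcendence at `0` is preserved by a nonzero constant factor. [folklore] -/
theorem transcendental_const_mul {w : ℂ → ℂ} {ζ : ℂ} (hζ : ζ ≠ 0)
    (htr : ∀ H : Polynomial (Polynomial ℂ), H ≠ 0 →
      ¬ (∀ᶠ u in 𝓝[≠] (0 : ℂ), (H.map (Polynomial.evalRingHom u⁻¹)).eval (w u) = 0))
    (H : Polynomial (Polynomial ℂ)) (hH0 : H ≠ 0) :
    ¬ (∀ᶠ u in 𝓝[≠] (0 : ℂ), (H.map (Polynomial.evalRingHom u⁻¹)).eval (ζ * w u) = 0) := by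
  intro h
  set Hζ : Polynomial (Polynomial ℂ) := H.comp (Polynomial.C (Polynomial.C ζ) * Polynomial.X) with hHζ
  refine htr Hζ ?_ ?_
  · rw [hHζ, Ne, Polynomial.comp_eq_zero_iff, not_or]
    refine ⟨hH0, fun h2 => ?_⟩
    have h3 := congrArg (fun q : Polynomial (Polynomial ℂ) => q.coeff 1) h2.2
    simp only [Polynomial.coeff_C_mul, Polynomial.coeff_X_one, mul_one, Polynomial.coeff_C_succ,
      Polynomial.mul_coeff_zero, Polynomial.coeff_X_zero, mul_zero] at h3
    exact hζ (by simpa using h3)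
  · filter_upwards [h] with u hu
    rw [hHζ, Polynomial.map_comp, Polynomial.eval_comp]
    simpa using hu

/-- Normal form of the resonant exponent: `c(iπr + 2πik)² = (iπx/2)(r + 2k)²`, `c = -ix/(2π)`.
[folklore] -/
theorem resonantExponent_eq (x r : ℂ) (k : ℂ) :
    -(I * x / (2 * Real.pi)) * (I * Real.pi * r + k * (2 * Real.pi * I)) ^ 2 =
      I * Real.pi * x / 2 * (r + 2 * k) ^ 2 := by
  have hπ : (Real.pi : ℂ) ≠ 0 := by exact_mod_cast Real.pi_ne_zero
  have e : I * Real.pi * r + k * (2 * Real.pi * I) = (I * Real.pi) * (r + 2 * k) := by ring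
  rw [e, mul_pow, mul_pow, Complex.I_sq]
  field_simp

/-- **Periodicity of the resonant phase.**  For `x, r ∈ ℚ`, `M = den x · den r` and all `k, q ∈ ℤ`:
`exp(c(iπr + 2πi(k + Mq))²) = exp(c(iπr + 2πik)²)`, `c = -ix/(2π)` (the exponents differ by `2πi`
times the integer `num x · num r · q + num x · den r · q (2k + Mq)`). [folklore] -/
theorem resonantPhase_periodic (x r : ℚ) (k q : ℤ) :
    Complex.exp (-(I * (x : ℂ) / (2 * Real.pi)) *
        (I * Real.pi * (r : ℂ) + ((k + (x.den * r.den : ℕ) * q : ℤ) : ℂ) * (2 * Real.pi * I)) ^ 2) =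
      Complex.exp (-(I * (x : ℂ) / (2 * Real.pi)) *
        (I * Real.pi * (r : ℂ) + (k : ℂ) * (2 * Real.pi * I)) ^ 2) := by
  have hx : (x : ℂ) * (x.den : ℂ) = (x.num : ℂ) := by exact_mod_cast Rat.mul_den_eq_num x
  have hr : (r : ℂ) * (r.den : ℂ) = (r.num : ℂ) := by exact_mod_cast Rat.mul_den_eq_num r
  set n : ℤ := x.num * r.num * q + x.num * r.den * q * (2 * k + (x.den * r.den : ℕ) * q) with hn
  rw [resonantExponent_eq, resonantExponent_eq, ← mul_one (Complex.exp (I * Real.pi * (x : ℂ) / 2 *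
    ((r : ℂ) + 2 * (k : ℂ)) ^ 2)), ← Complex.exp_int_mul_two_pi_mul_I n, ← Complex.exp_add]
  congr 1
  rw [hn]
  push_cast
  rw [← hx, ← hr]
  ring

/-- The resonant phase depends only on `k mod M`, `M = den x · den r`. [folklore] -/
theorem resonantPhase_eq_emod (x r : ℚ) (k : ℤ) :
    Complex.exp (-(I * (x : ℂ) / (2 * Real.pi)) *
        (I * Real.pi * (r : ℂ) + (k : ℂ) * (2 * Real.pi * I)) ^ 2) =
      Complex.exp (-(I * (x : ℂ) / (2 * Real.pi)) *
        (I * Real.pi * (r : ℂ) + ((k % (x.den * r.den : ℕ) : ℤ) : ℂ) * (2 * Real.pi * I)) ^ 2) := by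
  have h := resonantPhase_periodic x r (k % (x.den * r.den : ℕ)) (k / (x.den * r.den : ℕ))
  rw [Int.emod_add_mul_ediv] at h
  exact h ▸ rfl

/-! ## Part B. Density under rational resonance -/

section Main

variable (A B : Polynomial ℂ) {P : MvPolynomial (Fin 2) ℂ}

/-- **THE RATIONALLY RESONANT DEGENERATE GRAPH SURFACES ARE DENSE.**  `P(x₀, y₀) = A(x₀) y₀ + B(x₀)`
irreducible with two `y₀`-degrees; `deg A = deg B ≥ 1`, `A, B` coprime, `lc B = -e^{τ + iπr} lc A`
with `r ∈ ℚ`; `x ∈ ℚ ∖ {0}`, `κ ∈ ℂ`.  Then `{x₁ = -(ix/2π)(x₀ - τ)² + κ, P(x₀, y₀) = 0}` has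
Zariski-dense exponential points (THEOREM T on a subsequence of constant resonant phase).
[cite: MantovaMasser2023, §1 Further remarks, p. 5 (the question, open in general)] (new) -/
theorem unprojectedDense_ratResonantGraphSurface
    (hP : ∀ x y : ℂ, MvPolynomial.eval ![x, y] P = A.eval x * y + B.eval x) (hirr : Irreducible P)
    (h1 : ∃ v ∈ P.support, ∃ v' ∈ P.support, v 1 ≠ v' 1) (hN : 1 ≤ A.natDegree)
    (hdeg : B.natDegree = A.natDegree) (hcop : IsCoprime A B) (x r : ℚ) (hx : x ≠ 0) (τ κ : ℂ)
    (hlc : B.leadingCoeff = -Complex.exp (τ + I * Real.pi * r) * A.leadingCoeff) :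
    UnprojectedDense {w : Fin 2 ⊕ Fin 2 → ℂ |
      w (Sum.inl 1) = (Polynomial.C (-(I * (x : ℂ) / (2 * Real.pi))) *
        (Polynomial.X - Polynomial.C τ) ^ 2 + Polynomial.C κ).eval (w (Sum.inl 0)) ∧
      MvPolynomial.eval ![w (Sum.inl 0), w (Sum.inr 0)] P = 0} := by
  classical
  set c : ℂ := -(I * (x : ℂ) / (2 * Real.pi)) with hc
  set p : Polynomial ℂ := Polynomial.C c * (Polynomial.X - Polynomial.C τ) ^ 2 + Polynomial.C κ with hp
  set M : ℕ := x.den * r.den with hM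
  have hMpos : 0 < M := Nat.mul_pos x.den_pos r.den_pos
  set phase : ℤ → ℂ := fun k => Complex.exp (c * (I * Real.pi * (r : ℂ) + (k : ℂ) * (2 * Real.pi * I)) ^ 2)
    with hphase
  have hπ : (Real.pi : ℂ) ≠ 0 := by exact_mod_cast Real.pi_ne_zero
  have hc0 : c ≠ 0 := by
    rw [hc, neg_ne_zero, div_ne_zero_iff]
    exact ⟨mul_ne_zero Complex.I_ne_zero (by exact_mod_cast hx), mul_ne_zero two_ne_zero hπ⟩
  obtain ⟨w, R, hw, -, hK2, htr⟩ :=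
    exists_resonant_witness A B hN hdeg hcop hc0 τ (τ + I * Real.pi * r) κ hlc
  -- zeros and the shifted sequence
  obtain ⟨z, n, Al, Bl, hAl, hn, hz, hnear⟩ := exists_fibreCurve_zeros P h1
  have hnormz : Tendsto (fun k => ‖z k‖) atTop atTop := tendsto_norm_of_strip hAl hn hnear
  obtain ⟨k₀, hk₀⟩ := Filter.eventually_atTop.1 (hnormz.eventually_gt_atTop R)
  set z' : ℕ → ℂ := fun k => z (k + k₀) with hz'
  have hnormz' : Tendsto (fun k => ‖z' k‖) atTop atTop := hnormz.comp (tendsto_add_atTop_nat k₀)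
  have hPz : ∀ k, A.eval (z' k) * Complex.exp (z' k) + B.eval (z' k) = 0 := fun k => by
    rw [← hP]; exact hz (k + k₀)
  -- the resonant integers and their residues
  have hK2' : ∀ j, ∃ k : ℤ, Complex.exp (p.eval (z' j)) = phase k * w (z' j)⁻¹ := by
    intro j
    obtain ⟨k, -, hk⟩ := hK2 _ (hk₀ _ (Nat.le_add_left _ _)) (hPz j)
    refine ⟨k, ?_⟩
    rw [hp, hk, hphase]
    congr 2
    ring
  choose kk hkk using hK2'
  set g : ℕ → Fin M := fun j => ⟨((kk j) % (M : ℕ)).toNat, by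
    have h0 : 0 ≤ kk j % (M : ℕ) := Int.emod_nonneg _ (by exact_mod_cast hMpos.ne')
    have h1 : kk j % (M : ℕ) < (M : ℕ) := Int.emod_lt_of_pos _ (by exact_mod_cast hMpos)
    omega⟩ with hg
  obtain ⟨i₀, hi₀⟩ := Finite.exists_infinite_fiber g
  have hSinf : Set.Infinite (g ⁻¹' {i₀}) := Set.infinite_coe_iff.1 hi₀
  set ζ : ℂ := phase ((i₀ : ℕ) : ℤ) with hζ
  have hζ0 : ζ ≠ 0 := Complex.exp_ne_zero _
  have hphase_eq : ∀ j, g j = i₀ → phase (kk j) = ζ := by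
    intro j hj
    rw [hζ, hphase]
    simp only
    rw [hc, resonantPhase_eq_emod x r (kk j)]
    congr 3
    have h0 : 0 ≤ kk j % (M : ℕ) := Int.emod_nonneg _ (by exact_mod_cast hMpos.ne')
    have : ((i₀ : ℕ) : ℤ) = kk j % (M : ℕ) := by
      rw [← hj, hg]
      simp only
      exact Int.toNat_of_nonneg h0
    rw [← hM, this]
  -- the subsequence of constant phase
  set φ : ℕ → ℕ := Nat.nth (· ∈ g ⁻¹' {i₀}) with hφ
  have hφS : ∀ j, g (φ j) = i₀ := fun j => Nat.nth_mem_of_infinite (p := (· ∈ g ⁻¹' {i₀})) hSinf j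
  have hφtop : Tendsto φ atTop atTop := (Nat.nth_strictMono (p := (· ∈ g ⁻¹' {i₀})) hSinf).tendsto_atTop
  set z'' : ℕ → ℂ := fun j => z' (φ j) with hz''
  -- the sequence of exponential points
  have hirr3 := irreducible_rename_castSucc₂ hirr
  rw [fibreCurveSurface_eq]
  set q : ℕ → Fin 2 ⊕ Fin 2 → ℂ := fun j =>
    Sum.elim ![z'' j, p.eval (z'' j)] ![Complex.exp (z'' j), Complex.exp (p.eval (z'' j))] with hq
  have hqS : ∀ j, q j ∈ {w : Fin 2 ⊕ Fin 2 → ℂ | w (Sum.inl 1) = p.eval (w (Sum.inl 0)) ∧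
      MvPolynomial.eval ![w (Sum.inl 0), w (Sum.inr 0), w (Sum.inr 1)]
        (rename (Fin.castSucc : Fin 2 → Fin 3) P) = 0} := by
    intro j
    refine ⟨by simp [hq], ?_⟩
    have e : (![q j (Sum.inl 0), q j (Sum.inr 0), q j (Sum.inr 1)] : Fin 3 → ℂ) =
        ![z'' j, Complex.exp (z'' j), Complex.exp (p.eval (z'' j))] := by
      simp [hq]
    rw [e, eval_vec3_rename_castSucc]
    exact hz (φ j + k₀)
  have hqΓ : ∀ j, q j ∈ expGraph ℂ 2 := by
    intro j
    rw [mem_expGraph_iff]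
    intro i
    rw [Literature.ModelTheory.ExponentialFields.ExponentialRing.complex_exp_eq]
    fin_cases i <;> simp [hq]
  have hqnorm : Tendsto (fun j => ‖q j (Sum.inl 0)‖) atTop atTop := by
    refine (hnormz'.comp hφtop).congr fun j => ?_
    simp [hq, hz'']
  have hw' : AnalyticAt ℂ (fun u => ζ * w u) 0 := analyticAt_const.mul hw
  have hrel : ∀ j, q j (Sum.inr 1) = (fun u => ζ * w u) (q j (Sum.inl 0))⁻¹ := by
    intro j
    simp only [hq, Sum.elim_inr, Sum.elim_inl, Matrix.cons_val_one, Matrix.cons_val_zero, hz'']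
    rw [hkk (φ j), hphase_eq _ (hφS j)]
  exact unprojectedDense_of_transcendental_relation (isIrreducibleClosed_graphSurface p hirr3)
    (by rw [zariskiDim_graphSurface p hirr3]) 0 1 hqS hqΓ hqnorm hw' hrel
    (transcendental_const_mul hζ0 htr)

/-- **Case ∧ dense under rational resonance.**
[cite: MantovaMasser2023, §1 Further remarks, p. 5 (the question, open in general)] (new) -/
theorem unprojectedDensityQuestion_ratResonantGraphSurface
    (hP : ∀ x y : ℂ, MvPolynomial.eval ![x, y] P = A.eval x * y + B.eval x) (hirr : Irreducible P)
    (h1 : ∃ v ∈ P.support, ∃ v' ∈ P.support, v 1 ≠ v' 1) (hN : 1 ≤ A.natDegree)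
    (hdeg : B.natDegree = A.natDegree) (hcop : IsCoprime A B) (x r : ℚ) (hx : x ≠ 0) (τ κ : ℂ)
    (hlc : B.leadingCoeff = -Complex.exp (τ + I * Real.pi * r) * A.leadingCoeff) :
    MMCaseDimPiOneFree {w : Fin 2 ⊕ Fin 2 → ℂ |
      w (Sum.inl 1) = (Polynomial.C (-(I * (x : ℂ) / (2 * Real.pi))) *
        (Polynomial.X - Polynomial.C τ) ^ 2 + Polynomial.C κ).eval (w (Sum.inl 0)) ∧
      MvPolynomial.eval ![w (Sum.inl 0), w (Sum.inr 0)] P = 0} ∧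
    UnprojectedDense {w : Fin 2 ⊕ Fin 2 → ℂ |
      w (Sum.inl 1) = (Polynomial.C (-(I * (x : ℂ) / (2 * Real.pi))) *
        (Polynomial.X - Polynomial.C τ) ^ 2 + Polynomial.C κ).eval (w (Sum.inl 0)) ∧
      MvPolynomial.eval ![w (Sum.inl 0), w (Sum.inr 0)] P = 0} := by
  refine ⟨mmCase_fibreCurveSurface _ ?_ hirr ?_,
    unprojectedDense_ratResonantGraphSurface A B hP hirr h1 hN hdeg hcop x r hx τ κ hlc⟩
  · have hπ : (Real.pi : ℂ) ≠ 0 := by exact_mod_cast Real.pi_ne_zero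
    have hc : (-(I * (x : ℂ) / (2 * Real.pi)) : ℂ) ≠ 0 := by
      rw [neg_ne_zero, div_ne_zero_iff]
      exact ⟨mul_ne_zero Complex.I_ne_zero (by exact_mod_cast hx), mul_ne_zero two_ne_zero hπ⟩
    rw [Polynomial.natDegree_add_C, Polynomial.natDegree_C_mul hc, Polynomial.natDegree_pow,
      Polynomial.natDegree_X_sub_C]
  · have hA0 : A ≠ 0 := by
      intro h; rw [h, Polynomial.natDegree_zero] at hN; omega
    have hB0 : B ≠ 0 := by
      intro h
      rw [h, Polynomial.leadingCoeff_zero] at hlc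
      exact mul_ne_zero (neg_ne_zero.2 (Complex.exp_ne_zero _)) (Polynomial.leadingCoeff_ne_zero.2 hA0)
        hlc.symm
    refine ((Polynomial.finite_setOf_isRoot (mul_ne_zero hA0 hB0)).infinite_compl).mono ?_
    intro t ht
    simp only [Set.mem_compl_iff, Set.mem_setOf_eq, Polynomial.IsRoot, Polynomial.eval_mul,
      mul_eq_zero, not_or] at ht
    have hA : A.eval t ≠ 0 := ht.1
    refine ⟨-B.eval t / A.eval t, div_ne_zero (neg_ne_zero.2 ht.2) hA, ?_⟩
    rw [hP, mul_div_cancel₀ _ hA, neg_add_cancel]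

end Main

/-! ## Part C. Example: `{x₁ = -i x₀²/(4π), x₀ y₀ + x₀ + 1 = 0}` (`x = 1/2`, fibre limit `-1`) -/

section Example

/-- `P = x₀ y₀ + x₀ + 1` evaluates as `x·y + (x + 1)`. -/
theorem eval_halfResonantP (x y : ℂ) :
    MvPolynomial.eval ![x, y] (X 0 * X 1 + X 0 + 1 : MvPolynomial (Fin 2) ℂ) =
      (Polynomial.X : Polynomial ℂ).eval x * y + (Polynomial.X + 1 : Polynomial ℂ).eval x := by
  simp; ring

/-- `x₀ y₀ + x₀ + 1` is irreducible (`C(y₀ + 1)·X + C 1` under `finSuccEquiv`). -/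
theorem irreducible_halfResonantP : Irreducible (X 0 * X 1 + X 0 + 1 : MvPolynomial (Fin 2) ℂ) := by
  have himage : MvPolynomial.finSuccEquiv ℂ 1 (X 0 * X 1 + X 0 + 1) =
      Polynomial.C (X 0 + 1 : MvPolynomial (Fin 1) ℂ) * Polynomial.X + Polynomial.C 1 := by
    rw [map_add, map_add, map_mul, map_one, MvPolynomial.finSuccEquiv_X_zero,
      show (X 1 : MvPolynomial (Fin 2) ℂ) = X (Fin.succ 0) from rfl, MvPolynomial.finSuccEquiv_X_succ,
      map_add, map_one]
    ring
  have ha : (X 0 + 1 : MvPolynomial (Fin 1) ℂ) ≠ 0 := by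
    intro h
    have := congrArg (MvPolynomial.eval fun _ => (0 : ℂ)) h
    simp at this
  have hirr := irreducible_C_mul_X_add_C_of_isUnit (R := MvPolynomial (Fin 1) ℂ) ha isUnit_one
  rw [← himage] at hirr
  exact (MulEquiv.irreducible_iff (MvPolynomial.finSuccEquiv ℂ 1).toMulEquiv).1 hirr

/-- `P = x₀ y₀ + x₀ + 1` as a combination of monomials. -/
theorem halfResonantP_eq_monomials : (X 0 * X 1 + X 0 + 1 : MvPolynomial (Fin 2) ℂ) =
    MvPolynomial.monomial (Finsupp.single 0 1 + Finsupp.single 1 1) 1 +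
      MvPolynomial.monomial (Finsupp.single 0 1) 1 + MvPolynomial.monomial 0 1 := by
  simp only [MvPolynomial.X, MvPolynomial.monomial_mul, one_mul]
  rfl

/-- `x₀ y₀` and `1` are monomials of `x₀ y₀ + x₀ + 1` of different `y₀`-degree. -/
theorem halfResonantP_support_pair : ∃ v ∈ (X 0 * X 1 + X 0 + 1 : MvPolynomial (Fin 2) ℂ).support,
    ∃ v' ∈ (X 0 * X 1 + X 0 + 1 : MvPolynomial (Fin 2) ℂ).support, v 1 ≠ v' 1 := by
  have hne1 : (Finsupp.single (0 : Fin 2) 1 + Finsupp.single 1 1 : Fin 2 →₀ ℕ) ≠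
      Finsupp.single 0 1 := by
    intro h; have := DFunLike.congr_fun h 1; simp at this
  have hne2 : (Finsupp.single (0 : Fin 2) 1 + Finsupp.single 1 1 : Fin 2 →₀ ℕ) ≠ 0 := by
    intro h; have := DFunLike.congr_fun h 1; simp at this
  have hne3 : (Finsupp.single (0 : Fin 2) 1 : Fin 2 →₀ ℕ) ≠ 0 := by
    intro h; have := DFunLike.congr_fun h 0; simp at this
  refine ⟨Finsupp.single 0 1 + Finsupp.single 1 1, ?_, 0, ?_, by simp⟩
  · rw [MvPolynomial.mem_support_iff, halfResonantP_eq_monomials]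
    simp only [MvPolynomial.coeff_add, MvPolynomial.coeff_monomial, if_neg hne1.symm,
      if_neg hne2.symm]
    norm_num
  · rw [MvPolynomial.mem_support_iff, halfResonantP_eq_monomials]
    simp only [MvPolynomial.coeff_add, MvPolynomial.coeff_monomial, if_neg hne2, if_neg hne3]
    norm_num

/-- **`{x₁ = -i x₀²/(4π), x₀ y₀ + x₀ + 1 = 0}` is in the case and DENSE** (rational resonance
`x = 1/2`, fibre limit `-1 = e^{iπ}`; along its exponential points `e^{x₁}` has the two limit phases
`exp(iπk²)·w(0)`).
[cite: MantovaMasser2023, §1 Further remarks, p. 5 (the question, open in general)] (new) -/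
theorem unprojectedDensityQuestion_instance_halfResonantParabola :
    MMCaseDimPiOneFree {w : Fin 2 ⊕ Fin 2 → ℂ |
      w (Sum.inl 1) = -(I / (4 * Real.pi)) * w (Sum.inl 0) ^ 2 ∧
        w (Sum.inl 0) * w (Sum.inr 0) + w (Sum.inl 0) + 1 = 0} ∧
    UnprojectedDense {w : Fin 2 ⊕ Fin 2 → ℂ |
      w (Sum.inl 1) = -(I / (4 * Real.pi)) * w (Sum.inl 0) ^ 2 ∧
        w (Sum.inl 0) * w (Sum.inr 0) + w (Sum.inl 0) + 1 = 0} := by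
  have hπ : (Real.pi : ℂ) ≠ 0 := by exact_mod_cast Real.pi_ne_zero
  have hset : {w : Fin 2 ⊕ Fin 2 → ℂ |
      w (Sum.inl 1) = -(I / (4 * Real.pi)) * w (Sum.inl 0) ^ 2 ∧
        w (Sum.inl 0) * w (Sum.inr 0) + w (Sum.inl 0) + 1 = 0} =
      {w : Fin 2 ⊕ Fin 2 → ℂ |
        w (Sum.inl 1) = (Polynomial.C (-(I * (((1 / 2 : ℚ)) : ℂ) / (2 * Real.pi))) *
          (Polynomial.X - Polynomial.C 0) ^ 2 + Polynomial.C 0).eval (w (Sum.inl 0)) ∧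
        MvPolynomial.eval ![w (Sum.inl 0), w (Sum.inr 0)]
          (X 0 * X 1 + X 0 + 1 : MvPolynomial (Fin 2) ℂ) = 0} := by
    ext w
    simp only [Set.mem_setOf_eq, map_zero, sub_zero, add_zero, Polynomial.eval_mul, Polynomial.eval_C,
      Polynomial.eval_pow, Polynomial.eval_X, MvPolynomial.eval_X, map_add, map_mul, map_one,
      Matrix.cons_val_zero, Matrix.cons_val_one]
    have e : (-(I * (((1 / 2 : ℚ)) : ℂ) / (2 * Real.pi)) : ℂ) = -(I / (4 * Real.pi)) := by
      push_cast; field_simp; ring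
    rw [e]
  rw [hset]
  refine unprojectedDensityQuestion_ratResonantGraphSurface Polynomial.X (Polynomial.X + 1)
    eval_halfResonantP irreducible_halfResonantP halfResonantP_support_pair (by simp) ?_ ?_
    (1 / 2) 1 (by norm_num) 0 0 ?_
  · rw [Polynomial.natDegree_X, ← map_one Polynomial.C, Polynomial.natDegree_X_add_C]
  · exact ⟨-1, 1, by ring⟩
  · rw [← map_one Polynomial.C, Polynomial.leadingCoeff_X_add_C, Polynomial.leadingCoeff_X, zero_add,
      Rat.cast_one, mul_one, mul_comm I, mul_one, Complex.exp_pi_mul_I]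
    norm_num

end Example

end Summit.Schanuel.Schanuel.Theorems
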